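import Summits.Langlands.Statement
import HarnessLib

/-!
# Birth skeleton (BC3) for the child `WeakAutomorphyOffTateFrames` (B⁻) of the split of
`FifteenLocusEisenstein.SectorComplement` (stmt-Langlands-16058) — line `birth16058_WeakAutomorphyOffTateFrames`

B⁻ = Fontaine–Mazur–Langlands (a.e. form) OFF the Tate-frame sector, cut by the ARITHMETIC OF THE BASE FIELD — the one
dichotomy every known engine respects:

* `stub_offTateFrames_shimuraFields` — `K` totally real or CM: the world of Shimura varieties, potential automorphy and
  automorphy lifting (Taylor 2006, BLGGT 2014 Thm. C / 4.5.1 for regular, residually adequate `ρ`; ACC+ 2023 and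
  Caraiani–Newton 2023 over CM; Pan 2022 / Kisin FM for `GL₂/ℚ`); OPEN for irregular Hodge–Tate weights
  (NonRegularWeightBarrier), residually small image (SolvableImage / ResiduallyReducible barriers) and — the part this
  route's Target does NOT cover — everything over imaginary quadratic `K` that is not an a.e. Tate frame of a non-CM
  elliptic curve;
* `stub_offTateFrames_generalFields` — `K` neither totally real nor CM: no Shimura variety realises the relevant
  cohomology (ShimuraVarietyRealizationBarrier, ShtukaConstantFieldBarrier); only `n = 1` (class field theory), Artin-type
  and induced cases are known.  This is where a genuinely new construction is needed.

Composition `WeakAutomorphyOffTateFrames_of` = case split on `IsTotallyReal K ∨ IsCMField K`.  Conclusion stated as the TEXT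
of B⁻ (= the child decl by `Iff.rfl` once the split is rendered).  Imports `Summits.Langlands.Statement` only.
Sorries: exactly the two stubs.
-/

noncomputable section

set_option linter.dupNamespace false

open scoped NumberField Classical Polynomial
open Filter IsDedekindDomain Polynomial
open Literature.NumberTheory.Automorphic Literature.NumberTheory.GaloisRepresentations
open Summit.Langlands

namespace Summit.Langlands.Langlands.Cruxes.SectorComplement.Birth16058WeakAutomorphyOffTateFrames

/-- **stub B⁻[Shimura fields]** — B⁻ for `K` totally real or CM. [cite: FontaineMazurGeometric1995, Conj. 1]
[cite: BarnetlambEtAl2014, Thm. 4.5.1] [cite: ACCGHLNSTT2023, Thm. 1.0.2] -/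
theorem stub_offTateFrames_shimuraFields : ∀ (K : Type) [Field K] [NumberField K] (n : ℕ) (hcpt : Literature.NumberTheory.Automorphic.isCompact_glFiniteIntegralLevel n K), 0 < n → (NumberField.IsTotallyReal K ∨ NumberField.IsCMField K) → ∀ (ℓ : ℕ) [Fact ℓ.Prime] (ι : PadicAlgCl ℓ ≃+* ℂ) (ρ : Literature.NumberTheory.GaloisRepresentations.FramedGaloisRep K (PadicAlgCl ℓ) n), ρ.toGaloisRep.IsIrreducible → ((∀ᶠ v : IsDedekindDomain.HeightOneSpectrum (NumberField.RingOfIntegers K) in cofinite, ρ.IsUnramifiedAt v) ∧ ∀ (v : IsDedekindDomain.HeightOneSpectrum (NumberField.RingOfIntegers K)) (hv : ((ℓ : ℕ) : NumberField.RingOfIntegers K) ∈ v.asIdeal), (Literature.NumberTheory.PAdicHodge.fontainePstAdicCompletion v ℓ hv).IsDeRhamFramed (ρ.toLocal v)) → ¬ (NumberField.IsTotallyComplex K ∧ Module.finrank ℚ K = 2 ∧ n = 2 ∧ ∃ E : WeierstrassCurve (NumberField.RingOfIntegers K), E.Δ ≠ 0 ∧ ¬ (E.baseChange K).HasCM ∧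 ∀ᶠ w : IsDedekindDomain.HeightOneSpectrum (NumberField.RingOfIntegers K) in cofinite, ρ.IsUnramifiedAt w ∧ ρ.HasFrobCharpolyAt w (Polynomial.X ^ 2 - Polynomial.C ((Literature.NumberTheory.Automorphic.frobTraceAt E w : ℤ) : PadicAlgCl ℓ) * Polynomial.X + Polynomial.C ((w.residueCard : ℕ) : PadicAlgCl ℓ))) → ∃ π : Literature.NumberTheory.Automorphic.CuspidalAutomorphicRepData n K hcpt, π.1.IsLAlgebraic ∧ ∀ᶠ v : IsDedekindDomain.HeightOneSpectrum (NumberField.RingOfIntegers K) in cofinite, SatakeFrobCompatibleAt ι π.1 ρ v := by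
  sorry

/-- **stub B⁻[general fields]** — B⁻ for `K` neither totally real nor CM. [cite: FontaineMazurGeometric1995, Conj. 1]
[cite: BuzzardGeeLMS2014, Conj. 3.2.2] -/
theorem stub_offTateFrames_generalFields : ∀ (K : Type) [Field K] [NumberField K] (n : ℕ) (hcpt : Literature.NumberTheory.Automorphic.isCompact_glFiniteIntegralLevel n K), 0 < n → ¬ (NumberField.IsTotallyReal K ∨ NumberField.IsCMField K) → ∀ (ℓ : ℕ) [Fact ℓ.Prime] (ι : PadicAlgCl ℓ ≃+* ℂ) (ρ : Literature.NumberTheory.GaloisRepresentations.FramedGaloisRep K (PadicAlgCl ℓ) n), ρ.toGaloisRep.IsIrreducible → ((∀ᶠ v : IsDedekindDomain.HeightOneSpectrum (NumberField.RingOfIntegers K) in cofinite, ρ.IsUnramifiedAt v) ∧ ∀ (v : IsDedekindDomain.HeightOneSpectrum (NumberField.RingOfIntegers K)) (hv : ((ℓ : ℕ) : NumberField.RingOfIntegers K) ∈ v.asIdeal), (Literature.NumberTheory.PAdicHodge.fontainePstAdicCompletion v ℓ hv).IsDeRhamFramed (ρ.toLocal v)) → ¬ (NumberField.IsTotallyComplex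 K ∧ Module.finrank ℚ K = 2 ∧ n = 2 ∧ ∃ E : WeierstrassCurve (NumberField.RingOfIntegers K), E.Δ ≠ 0 ∧ ¬ (E.baseChange K).HasCM ∧ ∀ᶠ w : IsDedekindDomain.HeightOneSpectrum (NumberField.RingOfIntegers K) in cofinite, ρ.IsUnramifiedAt w ∧ ρ.HasFrobCharpolyAt w (Polynomial.X ^ 2 - Polynomial.C ((Literature.NumberTheory.Automorphic.frobTraceAt E w : ℤ) : PadicAlgCl ℓ) * Polynomial.X + Polynomial.C ((w.residueCard : ℕ) : PadicAlgCl ℓ))) → ∃ π : Literature.NumberTheory.Automorphic.CuspidalAutomorphicRepData n K hcpt, π.1.IsLAlgebraic ∧ ∀ᶠ v : IsDedekindDomain.HeightOneSpectrum (NumberField.RingOfIntegers K) in cofinite, SatakeFrobCompatibleAt ι π.1 ρ v := by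
  sorry

/-- **B⁻ from the two field regimes.** [folklore] -/
theorem WeakAutomorphyOffTateFrames_of :
    (∀ (K : Type) [Field K] [NumberField K] (n : ℕ) (hcpt : Literature.NumberTheory.Automorphic.isCompact_glFiniteIntegralLevel n K), 0 < n → (NumberField.IsTotallyReal K ∨ NumberField.IsCMField K) → ∀ (ℓ : ℕ) [Fact ℓ.Prime] (ι : PadicAlgCl ℓ ≃+* ℂ) (ρ : Literature.NumberTheory.GaloisRepresentations.FramedGaloisRep K (PadicAlgCl ℓ) n), ρ.toGaloisRep.IsIrreducible → ((∀ᶠ v : IsDedekindDomain.HeightOneSpectrum (NumberField.RingOfIntegers K) in cofinite, ρ.IsUnramifiedAt v) ∧ ∀ (v : IsDedekindDomain.HeightOneSpectrum (NumberField.RingOfIntegers K)) (hv : ((ℓ : ℕ) : NumberField.RingOfIntegers K) ∈ v.asIdeal), (Literature.NumberTheory.PAdicHodge.fontainePstAdicCompletion v ℓ hv).IsDeRhamFramed (ρ.toLocal v)) → ¬ (NumberField.IsTotallyComplex K ∧ Module.finrank ℚ K = 2 ∧ n = 2 ∧ ∃ E : WeierstrassCurve (NumberField.RingOfIntegers K),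 E.Δ ≠ 0 ∧ ¬ (E.baseChange K).HasCM ∧ ∀ᶠ w : IsDedekindDomain.HeightOneSpectrum (NumberField.RingOfIntegers K) in cofinite, ρ.IsUnramifiedAt w ∧ ρ.HasFrobCharpolyAt w (Polynomial.X ^ 2 - Polynomial.C ((Literature.NumberTheory.Automorphic.frobTraceAt E w : ℤ) : PadicAlgCl ℓ) * Polynomial.X + Polynomial.C ((w.residueCard : ℕ) : PadicAlgCl ℓ))) → ∃ π : Literature.NumberTheory.Automorphic.CuspidalAutomorphicRepData n K hcpt, π.1.IsLAlgebraic ∧ ∀ᶠ v : IsDedekindDomain.HeightOneSpectrum (NumberField.RingOfIntegers K) in cofinite, SatakeFrobCompatibleAt ι π.1 ρ v) →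
    (∀ (K : Type) [Field K] [NumberField K] (n : ℕ) (hcpt : Literature.NumberTheory.Automorphic.isCompact_glFiniteIntegralLevel n K), 0 < n → ¬ (NumberField.IsTotallyReal K ∨ NumberField.IsCMField K) → ∀ (ℓ : ℕ) [Fact ℓ.Prime] (ι : PadicAlgCl ℓ ≃+* ℂ) (ρ : Literature.NumberTheory.GaloisRepresentations.FramedGaloisRep K (PadicAlgCl ℓ) n), ρ.toGaloisRep.IsIrreducible → ((∀ᶠ v : IsDedekindDomain.HeightOneSpectrum (NumberField.RingOfIntegers K) in cofinite, ρ.IsUnramifiedAt v) ∧ ∀ (v : IsDedekindDomain.HeightOneSpectrum (NumberField.RingOfIntegers K)) (hv : ((ℓ : ℕ) : NumberField.RingOfIntegers K) ∈ v.asIdeal), (Literature.NumberTheory.PAdicHodge.fontainePstAdicCompletion v ℓ hv).IsDeRhamFramed (ρ.toLocal v)) → ¬ (NumberField.IsTotallyComplex K ∧ Module.finrank ℚ K = 2 ∧ n = 2 ∧ ∃ E : WeierstrassCurve (NumberField.RingOfIntegers K), E.Δ ≠ 0 ∧ ¬ (E.baseChange K).HasCM ∧ ∀ᶠ w : IsDedekindDomain.HeightOneSpectrum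 (NumberField.RingOfIntegers K) in cofinite, ρ.IsUnramifiedAt w ∧ ρ.HasFrobCharpolyAt w (Polynomial.X ^ 2 - Polynomial.C ((Literature.NumberTheory.Automorphic.frobTraceAt E w : ℤ) : PadicAlgCl ℓ) * Polynomial.X + Polynomial.C ((w.residueCard : ℕ) : PadicAlgCl ℓ))) → ∃ π : Literature.NumberTheory.Automorphic.CuspidalAutomorphicRepData n K hcpt, π.1.IsLAlgebraic ∧ ∀ᶠ v : IsDedekindDomain.HeightOneSpectrum (NumberField.RingOfIntegers K) in cofinite, SatakeFrobCompatibleAt ι π.1 ρ v) →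
    (∀ (K : Type) [Field K] [NumberField K] (n : ℕ) (hcpt : Literature.NumberTheory.Automorphic.isCompact_glFiniteIntegralLevel n K), 0 < n → ∀ (ℓ : ℕ) [Fact ℓ.Prime] (ι : PadicAlgCl ℓ ≃+* ℂ) (ρ : Literature.NumberTheory.GaloisRepresentations.FramedGaloisRep K (PadicAlgCl ℓ) n), ρ.toGaloisRep.IsIrreducible → ((∀ᶠ v : IsDedekindDomain.HeightOneSpectrum (NumberField.RingOfIntegers K) in cofinite, ρ.IsUnramifiedAt v) ∧ ∀ (v : IsDedekindDomain.HeightOneSpectrum (NumberField.RingOfIntegers K)) (hv : ((ℓ : ℕ) : NumberField.RingOfIntegers K) ∈ v.asIdeal), (Literature.NumberTheory.PAdicHodge.fontainePstAdicCompletion v ℓ hv).IsDeRhamFramed (ρ.toLocal v)) → ¬ (NumberField.IsTotallyComplex K ∧ Module.finrank ℚ K = 2 ∧ n = 2 ∧ ∃ E : WeierstrassCurve (NumberField.RingOfIntegers K), E.Δ ≠ 0 ∧ ¬ (E.baseChange K).HasCM ∧ ∀ᶠ w : IsDedekindDomain.HeightOneSpectrum (NumberField.RingOfIntegers K) in cofinite,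 ρ.IsUnramifiedAt w ∧ ρ.HasFrobCharpolyAt w (Polynomial.X ^ 2 - Polynomial.C ((Literature.NumberTheory.Automorphic.frobTraceAt E w : ℤ) : PadicAlgCl ℓ) * Polynomial.X + Polynomial.C ((w.residueCard : ℕ) : PadicAlgCl ℓ))) → ∃ π : Literature.NumberTheory.Automorphic.CuspidalAutomorphicRepData n K hcpt, π.1.IsLAlgebraic ∧ ∀ᶠ v : IsDedekindDomain.HeightOneSpectrum (NumberField.RingOfIntegers K) in cofinite, SatakeFrobCompatibleAt ι π.1 ρ v) := by
  intro h₁ h₂ K _ _ n hcpt hn ℓ _ ι ρ hirr hgeo hsec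
  by_cases hK : (NumberField.IsTotallyReal K ∨ NumberField.IsCMField K)
  · exact h₁ K n hcpt hn hK ℓ ι ρ hirr hgeo hsec
  · exact h₂ K n hcpt hn hK ℓ ι ρ hirr hgeo hsec

/-- B⁻ (text) from the stubs. -/
theorem WeakAutomorphyOffTateFrames_of_stubs : ∀ (K : Type) [Field K] [NumberField K] (n : ℕ) (hcpt : Literature.NumberTheory.Automorphic.isCompact_glFiniteIntegralLevel n K), 0 < n → ∀ (ℓ : ℕ) [Fact ℓ.Prime] (ι : PadicAlgCl ℓ ≃+* ℂ) (ρ : Literature.NumberTheory.GaloisRepresentations.FramedGaloisRep K (PadicAlgCl ℓ) n), ρ.toGaloisRep.IsIrreducible → ((∀ᶠ v : IsDedekindDomain.HeightOneSpectrum (NumberField.RingOfIntegers K) in cofinite, ρ.IsUnramifiedAt v) ∧ ∀ (v : IsDedekindDomain.HeightOneSpectrum (NumberField.RingOfIntegers K)) (hv : ((ℓ : ℕ) : NumberField.RingOfIntegers K) ∈ v.asIdeal), (Literature.NumberTheory.PAdicHodge.fontainePstAdicCompletion v ℓ hv).IsDeRhamFramed (ρ.toLocal v)) → ¬ (NumberField.IsTotallyComplex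 K ∧ Module.finrank ℚ K = 2 ∧ n = 2 ∧ ∃ E : WeierstrassCurve (NumberField.RingOfIntegers K), E.Δ ≠ 0 ∧ ¬ (E.baseChange K).HasCM ∧ ∀ᶠ w : IsDedekindDomain.HeightOneSpectrum (NumberField.RingOfIntegers K) in cofinite, ρ.IsUnramifiedAt w ∧ ρ.HasFrobCharpolyAt w (Polynomial.X ^ 2 - Polynomial.C ((Literature.NumberTheory.Automorphic.frobTraceAt E w : ℤ) : PadicAlgCl ℓ) * Polynomial.X + Polynomial.C ((w.residueCard : ℕ) : PadicAlgCl ℓ))) → ∃ π : Literature.NumberTheory.Automorphic.CuspidalAutomorphicRepData n K hcpt, π.1.IsLAlgebraic ∧ ∀ᶠ v : IsDedekindDomain.HeightOneSpectrum (NumberField.RingOfIntegers K) in cofinite, SatakeFrobCompatibleAt ι π.1 ρ v :=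
  WeakAutomorphyOffTateFrames_of stub_offTateFrames_shimuraFields stub_offTateFrames_generalFields

end Summit.Langlands.Langlands.Cruxes.SectorComplement.Birth16058WeakAutomorphyOffTateFrames

end
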